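import Summits.ResolutionOfSingularities.ResolutionOfSingularities.Theorems.HomologicalConductorSurfaceTerminationPrintDebtDoorsIff
import Summits.ResolutionOfSingularities.ResolutionOfSingularities.Theorems.HomologicalConductorNoZenoRKernelGenerated
import HarnessLib

/-!
# Kill test `SurfaceTermination` (stmt-ResolutionOfSingularities-16488): the doors with TWO prints —
# Lipman (4.1) is now a tree theorem

Route `ResolutionOfSingularities/HomologicalConductor`.  OURS (hand leafhand-res-homologicalconduct-23 g0, 2026-08-31);
nothing here is a statement of the manuscript under review (Hironaka 2017); AI-written, weaker than expert review.

The doors of record for the kill test (`PrintDebtDoorsThree`, `…Meet`, `…Iff`, hands 20 g0–g2) carry THREE prints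
{`CossartJannsenSaito2020General`, `Lipman1969_4_1`, `Lipman1969_12_1_ii`} plus a residue.  Since hand
leafhand-res-homologicalconduct-22 (p837605, `…NoZenoRKernelGenerated`) Lipman's Theorem (4.1) is a THEOREM of the tree,
`NoZeno.QuadraticTransform.Lipman1969_4_1_holds` (via Proposition (8.1), fact-free).  This file re-issues every door with
that binder DISCHARGED, so the exact print debt of 16488 along both lines (genus descent / capture) is now

  {CJS 2020 Thm 1.2 (`CossartJannsenSaito2020General`), Lipman 1969 Thm (12.1)(ii) (`Lipman1969_12_1_ii`)} + residue,

the residue being, equivalently (fact-free ⇒, two prints ⇐): (G) «no eternal positive constant geometric genus along a prime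
divisor», (E) an initial pair, (M) the meet, or (CAP) capture at non-rational prime-divisor stages.

* `primeDivisorSurfaceTermination_of_prints2_of_noEternalGenus`, `surfaceTermination_of_prints2_of_noEternalGenus`,
  `surfaceTermination_of_prints2_of_initialPair`, `surfaceTermination_of_prints2_of_meet`,
  `surfaceTermination_of_prints2_of_primeDivisorCapture` — TWO prints + residue ⇒ (D-s) / `SurfaceTermination` BY NAME;
* `primeDivisorSurfaceTermination_iff_noEternalGenus_of_prints2`, `surfaceTermination_iff_noEternalGenus_of_prints2`,
  `surfaceTermination_iff_meet_of_prints2` — the residues are normal forms of the kill test modulo the two prints.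

On the residue itself see the hand's memo `HAND23-PLATEAU-DICHOTOMY.md` (evidence on the item): at long-chain cusp / elliptic
stages either the cycle curve `E` is a Rees divisor of `\overline{ca}` (genus dies, but rung `PersistenceSurface` is refuted
by a low plateau) or it is not (the genus rides; if forever, (G) fails).  No new definitions; no crux, kill test or summit
statement is proved; resolution in positive characteristic is NOT proved.

References: J. Lipman, Publ. Math. IHÉS 36 (1969), (4.1), (8.1), (12.1) [`Lipman1969`]; V. Cossart, U. Jannsen, S. Saito
(2020), Thm. 1.2 [`CossartJannsenSaito2020`].
-/

set_option linter.dupNamespace false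

noncomputable section

namespace Summit.ResolutionOfSingularities.ResolutionOfSingularities.Theorems.SurfaceTermination.PrintDebtDoors

open Summit.ResolutionOfSingularities.ResolutionOfSingularities.Theses.HomologicalConductor (SurfaceTermination)
open Summit.ResolutionOfSingularities.ResolutionOfSingularities.Theorems
open Summit.ResolutionOfSingularities.ResolutionOfSingularities.Theorems.NoZeno.Birth
open Summit.ResolutionOfSingularities.ResolutionOfSingularities.Theorems.NoZeno.SandwichCluster
open Summit.ResolutionOfSingularities.ResolutionOfSingularities.Theorems.SurfaceTermination.GenusDescent
open Summit.ResolutionOfSingularities.ResolutionOfSingularities.Theorems.SurfaceTermination.Descent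
open Summit.ResolutionOfSingularities.ResolutionOfSingularities.Theorems.SurfaceTermination.Reduction
open Literature.AlgebraicGeometry.Resolution Literature.AlgebraicGeometry.Morphisms Polynomial
open Literature.RingTheory.CohomologyAnnihilator (cohomologyAnnihilator)
open CategoryTheory AlgebraicGeometry

/-! ## Two prints + (G) -/

/-- **TWO prints + (G) «no eternal positive constant genus along a prime divisor» ⇒ the prime-divisor case (D-s)**
(`…_of_prints3_…` with Lipman (4.1) discharged by `NoZeno.QuadraticTransform.Lipman1969_4_1_holds`).
[cite: CossartJannsenSaito2020, Thm. 1.2] [cite: Lipman1969, Theorem (12.1) (ii) (p. 220)] -/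
theorem primeDivisorSurfaceTermination_of_prints2_of_noEternalGenus
    (hCJS : CossartJannsenSaito2020General.{0}) (h12ii : Lipman1969_12_1_ii.{0})
    (hDrop : ∀ p : ℕ, p.Prime → ∀ (k K : Type) [Field k] [CharP k p] [Field K] [Algebra k K]
      (O : ValuationSubring K) (A : Subalgebra k K) (hk : ∀ c : k, algebraMap k K c ∈ O), A.FG →
      IsFractionRing ↥A K → A.toSubring ≤ O.toSubring → ringKrullDim ↥A = 2 →
      O ≠ ⊤ → IsDiscreteValuationRing ↥O → residueTrdeg k O hk + 1 = Algebra.trdeg k K →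
      ∀ g m : ℕ, (∀ m' : ℕ, m ≤ m' →
        HasGeometricGenusLE ↥(tower O A (m' + 1)) (g + 1) ∧ ¬ HasGeometricGenusLE ↥(tower O A (m' + 1)) g) →
        False) :
    PrimeDivisorSurfaceTermination :=
  primeDivisorSurfaceTermination_of_prints3_of_noEternalGenus hCJS NoZeno.QuadraticTransform.Lipman1969_4_1_holds
    h12ii hDrop

/-- **TWO prints + (G) ⇒ `SurfaceTermination` BY NAME.** [cite: CossartJannsenSaito2020, Thm. 1.2]
[cite: Lipman1969, Theorem (12.1) (ii) (p. 220)] -/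
theorem surfaceTermination_of_prints2_of_noEternalGenus
    (hCJS : CossartJannsenSaito2020General.{0}) (h12ii : Lipman1969_12_1_ii.{0})
    (hDrop : ∀ p : ℕ, p.Prime → ∀ (k K : Type) [Field k] [CharP k p] [Field K] [Algebra k K]
      (O : ValuationSubring K) (A : Subalgebra k K) (hk : ∀ c : k, algebraMap k K c ∈ O), A.FG →
      IsFractionRing ↥A K → A.toSubring ≤ O.toSubring → ringKrullDim ↥A = 2 →
      O ≠ ⊤ → IsDiscreteValuationRing ↥O → residueTrdeg k O hk + 1 = Algebra.trdeg k K →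
      ∀ g m : ℕ, (∀ m' : ℕ, m ≤ m' →
        HasGeometricGenusLE ↥(tower O A (m' + 1)) (g + 1) ∧ ¬ HasGeometricGenusLE ↥(tower O A (m' + 1)) g) →
        False) :
    SurfaceTermination :=
  surfaceTermination_of_prints3_of_noEternalGenus hCJS NoZeno.QuadraticTransform.Lipman1969_4_1_holds h12ii hDrop

/-! ## Two prints + (E) / (M) / (CAP) -/

/-- **TWO prints + the (E)-form residue (an initial pair of constant genus) ⇒ `SurfaceTermination` BY NAME.**
[cite: CossartJannsenSaito2020, Thm. 1.2] [cite: Lipman1969, Theorem (12.1) (ii) (p. 220)] -/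
theorem surfaceTermination_of_prints2_of_initialPair
    (hCJS : CossartJannsenSaito2020General.{0}) (h12ii : Lipman1969_12_1_ii.{0})
    (hPair : ∀ p : ℕ, p.Prime → ∀ (k K : Type) [Field k] [CharP k p] [Field K] [Algebra k K]
      (O : ValuationSubring K) (A : Subalgebra k K) (hk : ∀ c : k, algebraMap k K c ∈ O), A.FG →
      IsFractionRing ↥A K → A.toSubring ≤ O.toSubring → ringKrullDim ↥A = 2 →
      O ≠ ⊤ → IsDiscreteValuationRing ↥O → residueTrdeg k O hk + 1 = Algebra.trdeg k K →
      ∀ g m : ℕ, (∀ m' : ℕ, m ≤ m' →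
        HasGeometricGenusLE ↥(tower O A (m' + 1)) (g + 1) ∧ ¬ HasGeometricGenusLE ↥(tower O A (m' + 1)) g) →
        ∃ (m' : ℕ) (g₀ g₁ : K), g₀ ∈ ca (tower O A m') ∧ g₁ ∈ ca (tower O A m') ∧ g₀ ≠ 0 ∧
          (∀ c ∈ ca (tower O A m'), c * g₀⁻¹ ∈ O) ∧
          ∀ f : k[X], f ≠ 0 → ¬ O.valuation (aeval (g₁ * g₀⁻¹) f) < 1) :
    SurfaceTermination :=
  surfaceTermination_of_prints3_of_initialPair hCJS NoZeno.QuadraticTransform.Lipman1969_4_1_holds h12ii hPair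

/-- **TWO prints + the MEET residue (M) ⇒ `SurfaceTermination` BY NAME.** [cite: CossartJannsenSaito2020, Thm. 1.2]
[cite: Lipman1969, Theorem (12.1) (ii) (p. 220)] -/
theorem surfaceTermination_of_prints2_of_meet
    (hCJS : CossartJannsenSaito2020General.{0}) (h12ii : Lipman1969_12_1_ii.{0})
    (hMeet : ∀ p : ℕ, p.Prime → ∀ (k K : Type) [Field k] [CharP k p] [Field K] [Algebra k K]
      (O : ValuationSubring K) (A : Subalgebra k K) (hk : ∀ c : k, algebraMap k K c ∈ O), A.FG →
      IsFractionRing ↥A K → A.toSubring ≤ O.toSubring → ringKrullDim ↥A = 2 →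
      O ≠ ⊤ → IsDiscreteValuationRing ↥O → residueTrdeg k O hk + 1 = Algebra.trdeg k K →
      ∀ g m : ℕ, (∀ m' : ℕ, m ≤ m' →
        HasGeometricGenusLE ↥(tower O A (m' + 1)) (g + 1) ∧ ¬ HasGeometricGenusLE ↥(tower O A (m' + 1)) g) →
        (∀ m₁ : ℕ, ∃ i : ℕ, m₁ + 1 ≤ i ∧ ¬ IsRegularLocalRing ↥(tower O A i) ∧
          ¬ HasRationalSingularity ↥(tower O A i) ∧
          ∃ (S : Subalgebra k K) (hTS : tower O A i ≤ S),
            (∀ t ∈ tower O A i, t⁻¹ ∈ S → t⁻¹ ∈ tower O A i) ∧ IsRegularLocalRing ↥S ∧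
            Algebra.EssFiniteType k ↥S ∧
            ¬ (Ideal.map (Subalgebra.inclusion hTS).toRingHom (cohomologyAnnihilator ↥(tower O A i))).IsPrincipal) →
        False) :
    SurfaceTermination :=
  surfaceTermination_of_prints3_of_meet hCJS NoZeno.QuadraticTransform.Lipman1969_4_1_holds h12ii hMeet

/-- **TWO prints + capture at non-rational prime-divisor stages (CAP) ⇒ `SurfaceTermination` BY NAME.**
[cite: CossartJannsenSaito2020, Thm. 1.2] [cite: Lipman1969, Theorem (12.1) (ii) (p. 220)] -/
theorem surfaceTermination_of_prints2_of_primeDivisorCapture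
    (hCJS : CossartJannsenSaito2020General.{0}) (h12ii : Lipman1969_12_1_ii.{0})
    (hCAP : ∀ p : ℕ, p.Prime → ∀ (k K : Type) [Field k] [CharP k p] [Field K] [Algebra k K]
      (O : ValuationSubring K) (A : Subalgebra k K) (hk : ∀ c : k, algebraMap k K c ∈ O), A.FG →
      IsFractionRing ↥A K → A.toSubring ≤ O.toSubring → ringKrullDim ↥A = 2 →
      O ≠ ⊤ → IsDiscreteValuationRing ↥O → residueTrdeg k O hk + 1 = Algebra.trdeg k K →
      ∀ m : ℕ, ¬ IsRegularLocalRing ↥(tower O A (m + 1)) → ¬ HasRationalSingularity ↥(tower O A (m + 1)) →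
      ∀ (S : Subalgebra k K) (hTS : tower O A (m + 1) ≤ S),
        (∀ t ∈ tower O A (m + 1), t⁻¹ ∈ S → t⁻¹ ∈ tower O A (m + 1)) →
        IsRegularLocalRing ↥S → Algebra.EssFiniteType k ↥S →
        (Ideal.map (Subalgebra.inclusion hTS).toRingHom
          (cohomologyAnnihilator ↥(tower O A (m + 1)))).IsPrincipal) :
    SurfaceTermination :=
  surfaceTermination_of_prints3_of_primeDivisorCapture hCJS NoZeno.QuadraticTransform.Lipman1969_4_1_holds h12ii hCAP

/-! ## Normal forms modulo two prints -/

/-- **(D-s) ⟺ (G) modulo the TWO prints** {CJS 2020 Thm 1.2, Lipman (12.1)(ii)}.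
[cite: CossartJannsenSaito2020, Thm. 1.2] [cite: Lipman1969, Theorem (12.1) (ii) (p. 220)] -/
theorem primeDivisorSurfaceTermination_iff_noEternalGenus_of_prints2
    (hCJS : CossartJannsenSaito2020General.{0}) (h12ii : Lipman1969_12_1_ii.{0}) :
    PrimeDivisorSurfaceTermination ↔
      ∀ p : ℕ, p.Prime → ∀ (k K : Type) [Field k] [CharP k p] [Field K] [Algebra k K]
        (O : ValuationSubring K) (A : Subalgebra k K) (hk : ∀ c : k, algebraMap k K c ∈ O), A.FG →
        IsFractionRing ↥A K → A.toSubring ≤ O.toSubring → ringKrullDim ↥A = 2 →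
        O ≠ ⊤ → IsDiscreteValuationRing ↥O → residueTrdeg k O hk + 1 = Algebra.trdeg k K →
        ∀ g m : ℕ, (∀ m' : ℕ, m ≤ m' →
          HasGeometricGenusLE ↥(tower O A (m' + 1)) (g + 1) ∧ ¬ HasGeometricGenusLE ↥(tower O A (m' + 1)) g) →
          False :=
  primeDivisorSurfaceTermination_iff_noEternalGenus_of_prints3 hCJS NoZeno.QuadraticTransform.Lipman1969_4_1_holds h12ii

/-- **`SurfaceTermination` ⟺ (G) modulo the TWO prints.** [cite: CossartJannsenSaito2020, Thm. 1.2]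
[cite: Lipman1969, Theorem (12.1) (ii) (p. 220)] -/
theorem surfaceTermination_iff_noEternalGenus_of_prints2
    (hCJS : CossartJannsenSaito2020General.{0}) (h12ii : Lipman1969_12_1_ii.{0}) :
    SurfaceTermination ↔
      ∀ p : ℕ, p.Prime → ∀ (k K : Type) [Field k] [CharP k p] [Field K] [Algebra k K]
        (O : ValuationSubring K) (A : Subalgebra k K) (hk : ∀ c : k, algebraMap k K c ∈ O), A.FG →
        IsFractionRing ↥A K → A.toSubring ≤ O.toSubring → ringKrullDim ↥A = 2 →
        O ≠ ⊤ → IsDiscreteValuationRing ↥O → residueTrdeg k O hk + 1 = Algebra.trdeg k K →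
        ∀ g m : ℕ, (∀ m' : ℕ, m ≤ m' →
          HasGeometricGenusLE ↥(tower O A (m' + 1)) (g + 1) ∧ ¬ HasGeometricGenusLE ↥(tower O A (m' + 1)) g) →
          False :=
  surfaceTermination_iff_noEternalGenus_of_prints3 hCJS NoZeno.QuadraticTransform.Lipman1969_4_1_holds h12ii

/-- **`SurfaceTermination` ⟺ (M) modulo the TWO prints.** [cite: CossartJannsenSaito2020, Thm. 1.2]
[cite: Lipman1969, Theorem (12.1) (ii) (p. 220)] -/
theorem surfaceTermination_iff_meet_of_prints2
    (hCJS : CossartJannsenSaito2020General.{0}) (h12ii : Lipman1969_12_1_ii.{0}) :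
    SurfaceTermination ↔
      ∀ p : ℕ, p.Prime → ∀ (k K : Type) [Field k] [CharP k p] [Field K] [Algebra k K]
        (O : ValuationSubring K) (A : Subalgebra k K) (hk : ∀ c : k, algebraMap k K c ∈ O), A.FG →
        IsFractionRing ↥A K → A.toSubring ≤ O.toSubring → ringKrullDim ↥A = 2 →
        O ≠ ⊤ → IsDiscreteValuationRing ↥O → residueTrdeg k O hk + 1 = Algebra.trdeg k K →
        ∀ g m : ℕ, (∀ m' : ℕ, m ≤ m' →
          HasGeometricGenusLE ↥(tower O A (m' + 1)) (g + 1) ∧ ¬ HasGeometricGenusLE ↥(tower O A (m' + 1)) g) →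
          (∀ m₁ : ℕ, ∃ i : ℕ, m₁ + 1 ≤ i ∧ ¬ IsRegularLocalRing ↥(tower O A i) ∧
            ¬ HasRationalSingularity ↥(tower O A i) ∧
            ∃ (S : Subalgebra k K) (hTS : tower O A i ≤ S),
              (∀ t ∈ tower O A i, t⁻¹ ∈ S → t⁻¹ ∈ tower O A i) ∧ IsRegularLocalRing ↥S ∧
              Algebra.EssFiniteType k ↥S ∧
              ¬ (Ideal.map (Subalgebra.inclusion hTS).toRingHom
                  (cohomologyAnnihilator ↥(tower O A i))).IsPrincipal) →
          False :=
  surfaceTermination_iff_meet_of_prints3 hCJS NoZeno.QuadraticTransform.Lipman1969_4_1_holds h12ii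

/-! ## The engine and the reduction, modulo two prints (appended by the same hand) -/

/-- **(R2) RATIONAL STAGES TERMINATE, modulo TWO prints** {CJS 2020 Thm 1.2, Lipman (12.1)(ii)}: `Descent.FourFacts.rationalStageTermination4`
with Lipman (1.2) (`NoZeno.Lipman12B.Lipman1969_1_2_holds`, hand 18) and Lipman (4.1) (`NoZeno.QuadraticTransform.Lipman1969_4_1_holds`,
hand 22) discharged.  For the route's datum with `ringKrullDim A = 2` and any valuation ring `O ∋ k`: a rational stage `T_(m₁+1)` is
followed by a regular stage. [cite: CossartJannsenSaito2020, Thm. 1.2] [cite: Lipman1969, Theorem (12.1) (ii) (p. 220)] -/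
theorem rationalStageTermination_of_prints2
    (hCJS : CossartJannsenSaito2020General.{0}) (h12ii : Lipman1969_12_1_ii.{0})
    (p : ℕ) (hp : p.Prime) (k K : Type) [Field k] [CharP k p] [Field K] [Algebra k K]
    (O : ValuationSubring K) (A : Subalgebra k K) (hk : ∀ c : k, algebraMap k K c ∈ O) (hA : A.FG)
    (hfr : IsFractionRing ↥A K) (hAO : A.toSubring ≤ O.toSubring) (hdimA : ringKrullDim ↥A = 2)
    (m₁ : ℕ) (hrat₁ : HasRationalSingularity ↥(tower O A (m₁ + 1))) :
    ∃ m : ℕ, IsRegularLocalRing ↥(tower O A m) :=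
  Descent.FourFacts.rationalStageTermination4
    ⟨hCJS, NoZeno.Lipman12B.Lipman1969_1_2_holds, NoZeno.QuadraticTransform.Lipman1969_4_1_holds, h12ii⟩
    p hp k K O A hk hA hfr hAO hdimA m₁ hrat₁

/-- **(c1) `ExhaustiveSurfaceTermination`, modulo TWO prints** (`Reduction.FourFacts.exhaustiveSurfaceTermination_of_facts4` with
(1.2), (4.1) discharged). [cite: CossartJannsenSaito2020, Thm. 1.2] [cite: Lipman1969, Theorem (12.1) (ii) (p. 220)] -/
theorem exhaustiveSurfaceTermination_of_prints2
    (hCJS : CossartJannsenSaito2020General.{0}) (h12ii : Lipman1969_12_1_ii.{0}) :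
    ExhaustiveSurfaceTermination :=
  Reduction.FourFacts.exhaustiveSurfaceTermination_of_facts4
    ⟨hCJS, NoZeno.Lipman12B.Lipman1969_1_2_holds, NoZeno.QuadraticTransform.Lipman1969_4_1_holds, h12ii⟩

/-- **THE REDUCTION TO THE PRIME-DIVISOR CASE, modulo TWO prints**: (D-s) `PrimeDivisorSurfaceTermination` ⇒ `SurfaceTermination`
BY NAME (`Reduction.FourFacts.surfaceTermination_of_primeDivisorCase_of_facts4` with (1.2), (4.1) discharged).
[cite: CossartJannsenSaito2020, Thm. 1.2] [cite: Lipman1969, Theorem (12.1) (ii) (p. 220)] -/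
theorem surfaceTermination_of_primeDivisorCase_of_prints2
    (hCJS : CossartJannsenSaito2020General.{0}) (h12ii : Lipman1969_12_1_ii.{0})
    (hDs : PrimeDivisorSurfaceTermination) : SurfaceTermination :=
  Reduction.FourFacts.surfaceTermination_of_primeDivisorCase_of_facts4
    ⟨hCJS, NoZeno.Lipman12B.Lipman1969_1_2_holds, NoZeno.QuadraticTransform.Lipman1969_4_1_holds, h12ii⟩ hDs

end Summit.ResolutionOfSingularities.ResolutionOfSingularities.Theorems.SurfaceTermination.PrintDebtDoors

end
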